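import Literature.Probability.Percolation.TwoSetExchange
import HarnessLib

/-!
# `NoHeavyLowerTail` (stmt-CriticalPhenomena-4575) — trace-pattern bookkeeping for the k-fold giant Kozma–Nitzan argument

Support file (prover `prim-lf-7`; `--supports stmt-CriticalPhenomena-4575`).  No definitions, no named facts, no sorries.

Setting: `μ = prodBernoulli w` on `Fin n`, relays `A`, level `j`, `|π(v)| = (A.filter fun a => ω ∈ openConn v a).card`, "heavy" `:= j+1 ≤ |π(v)|`.
For a point set `S = insert c T` (`c ∉ T`) and `B ⊆ T` the TRACE PATTERN event is `{∀ s ∈ S, (s heavy ↔ s ∈ B)}` and the co-pattern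
`{∀ s ∈ S, (s heavy ↔ s ∈ S \ B)}`.  This file proves the exact identities (I1), (I2) of the k-fold KN blueprint
(prim-lf-7 BLUEPRINT-KNB.md), all ladder-free:
* `GiantKn.sum_pattern_eq` (I2a):  `Σ_{x ∈ B ⊆ T} μ(pattern B) = μ(x heavy, c light)`;
* `GiantKn.sum_copattern_eq` (I2b): `Σ_{x ∈ B ⊆ T} μ(co-pattern B) = μ(c heavy, x light)`
  (so `Σ_{B ∋ x} (m_B − m_{S∖B}) = h_x − h_c`, the telescoping step of KN Thm 2 for any number of points);
* `GiantKn.attachedHeavy_eq_sum` (I1a): `μ(o ↔ T, o heavy, c light) = Σ_{∅ ≠ B ⊆ T} μ(pattern B, o ↔ B)`;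
* `GiantKn.attachedLight_eq_sum` (I1b): `μ(o ↔ T, o light, c heavy) = Σ_{∅ ≠ B ⊆ T} μ(co-pattern B, o ↔ B)`
  (so `slack(XZ_T) = Σ_B (P_B − N_B)`, each difference being bounded by `giant_knStep w A B (S∖B) o j`).
[cite: KozmaNitzan2024, proof of Thm. 2 (pp. 8–9): "break P(0↔b↔A) according to the subset C(0)∩A and break P(0↔A, a₃↔b)
according to subset C(b)∩A"]
-/

noncomputable section

namespace Summit.CriticalPhenomena.PercolationContinuityZ3.Theorems

open MeasureTheory Set Literature.Probability.LatticeModels Literature.Probability.Percolation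
open scoped Classical BigOperators

variable {n : ℕ}

namespace GiantKn

/-- Distinct trace patterns are disjoint events. -/
theorem pattern_disjoint (A S : Finset (Fin n)) (j : ℕ) {B B' : Finset (Fin n)} (hB : B ⊆ S) (hB' : B' ⊆ S) (hne : B ≠ B') :
    Disjoint {ω : BondConfig (Fin n) | ∀ s ∈ S, (j + 1 ≤ (A.filter fun a => ω ∈ openConn s a).card ↔ s ∈ B)}
      {ω : BondConfig (Fin n) | ∀ s ∈ S, (j + 1 ≤ (A.filter fun a => ω ∈ openConn s a).card ↔ s ∈ B')} := by
  rw [Set.disjoint_left]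
  intro ω h h'
  apply hne
  ext s
  constructor
  · intro hs; exact ((h' s (hB hs)).1 ((h s (hB hs)).2 hs))
  · intro hs; exact ((h s (hB' hs)).1 ((h' s (hB' hs)).2 hs))

/-- **(I2a)** `Σ_{B ⊆ T, x ∈ B} μ(trace pattern of S on B) = μ(x heavy, c light)` for `S = insert c T`, `c ∉ T`, `x ∈ T`. -/
theorem sum_pattern_eq (w : Sym2 (Fin n) → unitInterval) (A S T : Finset (Fin n)) (c x : Fin n) (j : ℕ)
    (hS : S = insert c T) (hc : c ∉ T) (hx : x ∈ T) :
    ∑ B ∈ T.powerset.filter (fun B => x ∈ B),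
        (prodBernoulli w).real {ω : BondConfig (Fin n) | ∀ s ∈ S, (j + 1 ≤ (A.filter fun a => ω ∈ openConn s a).card ↔ s ∈ B)} =
      (prodBernoulli w).real ({ω : BondConfig (Fin n) | j + 1 ≤ (A.filter fun a => ω ∈ openConn x a).card} ∩
        {ω | (A.filter fun a => ω ∈ openConn c a).card ≤ j}) := by
  have hTS : T ⊆ S := by rw [hS]; exact Finset.subset_insert c T
  have hxS : x ∈ S := hTS hx
  have hcS : c ∈ S := by rw [hS]; exact Finset.mem_insert_self c T
  rw [← measureReal_biUnion_finset]
  · congr 1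
    ext ω
    simp only [mem_iUnion, exists_prop, Finset.mem_filter, Finset.mem_powerset, mem_setOf_eq, mem_inter_iff]
    constructor
    · rintro ⟨B, ⟨hBT, hxB⟩, hpat⟩
      refine ⟨(hpat x hxS).2 hxB, ?_⟩
      have : ¬ (j + 1 ≤ (A.filter fun a => ω ∈ openConn c a).card) := fun h => hc (hBT ((hpat c hcS).1 h))
      omega
    · rintro ⟨hxh, hcl⟩
      refine ⟨S.filter (fun s => j + 1 ≤ (A.filter fun a => ω ∈ openConn s a).card), ⟨?_, ?_⟩, ?_⟩
      · intro s hs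
        rw [Finset.mem_filter] at hs
        have hsS := hs.1
        rw [hS, Finset.mem_insert] at hsS
        rcases hsS with rfl | hsT
        · exfalso; have := hs.2; omega
        · exact hsT
      · rw [Finset.mem_filter]; exact ⟨hxS, hxh⟩
      · intro s hs; rw [Finset.mem_filter]; exact ⟨fun h => ⟨hs, h⟩, fun h => h.2⟩
  · intro B hB B' hB' hne
    simp only [Finset.coe_filter, Finset.mem_powerset, mem_setOf_eq] at hB hB'
    exact pattern_disjoint A S j (hB.1.trans hTS) (hB'.1.trans hTS) hne
  · intro B _; exact MeasurableSet.of_discrete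

/-- **(I2b)** `Σ_{B ⊆ T, x ∈ B} μ(trace pattern of S on S∖B) = μ(c heavy, x light)` for `S = insert c T`, `c ∉ T`, `x ∈ T`.
Together with (I2a): `Σ_{B ∋ x} (m_B − m_{S∖B}) = μ(x heavy) − μ(c heavy)`. -/
theorem sum_copattern_eq (w : Sym2 (Fin n) → unitInterval) (A S T : Finset (Fin n)) (c x : Fin n) (j : ℕ)
    (hS : S = insert c T) (hc : c ∉ T) (hx : x ∈ T) :
    ∑ B ∈ T.powerset.filter (fun B => x ∈ B),
        (prodBernoulli w).real {ω : BondConfig (Fin n) | ∀ s ∈ S, (j + 1 ≤ (A.filter fun a => ω ∈ openConn s a).card ↔ s ∈ S \ B)} =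
      (prodBernoulli w).real ({ω : BondConfig (Fin n) | j + 1 ≤ (A.filter fun a => ω ∈ openConn c a).card} ∩
        {ω | (A.filter fun a => ω ∈ openConn x a).card ≤ j}) := by
  have hTS : T ⊆ S := by rw [hS]; exact Finset.subset_insert c T
  have hxS : x ∈ S := hTS hx
  have hcS : c ∈ S := by rw [hS]; exact Finset.mem_insert_self c T
  have hxc : x ≠ c := fun h => hc (h ▸ hx)
  rw [← measureReal_biUnion_finset]
  · congr 1
    ext ω
    simp only [mem_iUnion, exists_prop, Finset.mem_filter, Finset.mem_powerset, mem_setOf_eq, mem_inter_iff, Finset.mem_sdiff]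
    constructor
    · rintro ⟨B, ⟨hBT, hxB⟩, hpat⟩
      refine ⟨(hpat c hcS).2 ⟨hcS, fun h => hc (hBT h)⟩, ?_⟩
      have : ¬ (j + 1 ≤ (A.filter fun a => ω ∈ openConn x a).card) := fun h => ((hpat x hxS).1 h).2 hxB
      omega
    · rintro ⟨hch, hxl⟩
      refine ⟨T.filter (fun s => ¬ j + 1 ≤ (A.filter fun a => ω ∈ openConn s a).card), ⟨Finset.filter_subset _ _, ?_⟩, ?_⟩
      · rw [Finset.mem_filter]; exact ⟨hx, by omega⟩
      · intro s hs
        rw [Finset.mem_filter]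
        constructor
        · intro h; exact ⟨hs, fun h' => h'.2 h⟩
        · rintro ⟨_, hnot⟩
          by_contra hlt
          have hsT : s ∈ T := by
            rw [hS, Finset.mem_insert] at hs
            rcases hs with rfl | hsT
            · exact absurd hch hlt
            · exact hsT
          exact hnot ⟨hsT, hlt⟩
  · intro B hB B' hB' hne
    simp only [Finset.coe_filter, Finset.mem_powerset, mem_setOf_eq] at hB hB'
    have hne' : S \ B ≠ S \ B' := by
      intro h; apply hne
      have e1 : S \ (S \ B) = B := Finset.sdiff_sdiff_eq_self (hB.1.trans hTS)
      have e2 : S \ (S \ B') = B' := Finset.sdiff_sdiff_eq_self (hB'.1.trans hTS)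
      rw [← e1, ← e2, h]
    exact pattern_disjoint A S j Finset.sdiff_subset Finset.sdiff_subset hne'
  · intro B _; exact MeasurableSet.of_discrete

/-- **(I1a)** the positive side of `XZ_T` broken according to the trace pattern `B = C(o) ∩ S`:
`μ(o ↔ T, o heavy, c light) = Σ_{∅ ≠ B ⊆ T} μ(trace pattern B, o ↔ B)` (`S = insert c T`, `c ∉ T`; ladder-free). -/
theorem attachedHeavy_eq_sum (w : Sym2 (Fin n) → unitInterval) (A S T : Finset (Fin n)) (o c : Fin n) (j : ℕ)
    (hS : S = insert c T) (hc : c ∉ T) :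
    (prodBernoulli w).real ((⋃ t ∈ T, (openConn o t : Set (BondConfig (Fin n)))) ∩
        {ω | j + 1 ≤ (A.filter fun a => ω ∈ openConn o a).card} ∩ {ω | (A.filter fun a => ω ∈ openConn c a).card ≤ j}) =
      ∑ B ∈ T.powerset.filter (fun B => B.Nonempty),
        (prodBernoulli w).real ({ω : BondConfig (Fin n) | ∀ s ∈ S, (j + 1 ≤ (A.filter fun a => ω ∈ openConn s a).card ↔ s ∈ B)} ∩
          ⋃ s ∈ B, (openConn s o : Set (BondConfig (Fin n)))) := by
  have hTS : T ⊆ S := by rw [hS]; exact Finset.subset_insert c T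
  have hcS : c ∈ S := by rw [hS]; exact Finset.mem_insert_self c T
  have card_eq : ∀ {u v : Fin n} {ω : BondConfig (Fin n)}, (openGraph ω).Reachable u v →
      (A.filter fun a => ω ∈ openConn u a).card = (A.filter fun a => ω ∈ openConn v a).card := by
    intro u v ω h; congr 1; ext b
    simp only [Finset.mem_filter, openConn, mem_setOf_eq]
    exact and_congr_right fun _ => ⟨fun hub => h.symm.trans hub, fun hvb => h.trans hvb⟩
  rw [← measureReal_biUnion_finset]
  · congr 1
    ext ω
    simp only [mem_iUnion, exists_prop, Finset.mem_filter, Finset.mem_powerset, mem_setOf_eq, mem_inter_iff]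
    constructor
    · rintro ⟨⟨⟨t, htT, hot'⟩, hoh⟩, hcl⟩
      have hot : (openGraph ω).Reachable o t := hot'
      refine ⟨T.filter (fun s => j + 1 ≤ (A.filter fun a => ω ∈ openConn s a).card), ⟨Finset.filter_subset _ _, ⟨t, ?_⟩⟩, ?_, ⟨t, ?_, show (openGraph ω).Reachable t o from hot.symm⟩⟩
      · rw [Finset.mem_filter]; exact ⟨htT, by rw [← card_eq hot]; exact hoh⟩
      · intro s hs
        rw [Finset.mem_filter]
        constructor
        · intro h
          have hsT : s ∈ T := by
            rw [hS, Finset.mem_insert] at hs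
            rcases hs with rfl | hsT
            · exfalso; omega
            · exact hsT
          exact ⟨hsT, h⟩
        · exact fun h => h.2
      · rw [Finset.mem_filter]; exact ⟨htT, by rw [← card_eq hot]; exact hoh⟩
    · rintro ⟨B, ⟨hBT, _⟩, hpat, ⟨s, hsB, hso'⟩⟩
      have hso : (openGraph ω).Reachable s o := hso'
      have hsh : j + 1 ≤ (A.filter fun a => ω ∈ openConn s a).card := (hpat s (hTS (hBT hsB))).2 hsB
      refine ⟨⟨⟨s, hBT hsB, show (openGraph ω).Reachable o s from hso.symm⟩, by rw [card_eq hso.symm]; exact hsh⟩, ?_⟩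
      have : ¬ (j + 1 ≤ (A.filter fun a => ω ∈ openConn c a).card) := fun h => hc (hBT ((hpat c hcS).1 h))
      omega
  · intro B hB B' hB' hne
    simp only [Finset.coe_filter, Finset.mem_powerset, mem_setOf_eq] at hB hB'
    exact Disjoint.mono inter_subset_left inter_subset_left (pattern_disjoint A S j (hB.1.trans hTS) (hB'.1.trans hTS) hne)
  · intro B _; exact MeasurableSet.of_discrete

/-- **(I1b)** the negative side of `XZ_T` broken according to the co-pattern `S∖B = Γ ∩ S`:
`μ(o ↔ T, o light, c heavy) = Σ_{∅ ≠ B ⊆ T} μ(trace pattern S∖B, o ↔ B)` (`S = insert c T`, `c ∉ T`; ladder-free). -/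
theorem attachedLight_eq_sum (w : Sym2 (Fin n) → unitInterval) (A S T : Finset (Fin n)) (o c : Fin n) (j : ℕ)
    (hS : S = insert c T) (hc : c ∉ T) :
    (prodBernoulli w).real ((⋃ t ∈ T, (openConn o t : Set (BondConfig (Fin n)))) ∩
        {ω | (A.filter fun a => ω ∈ openConn o a).card ≤ j} ∩ {ω | j + 1 ≤ (A.filter fun a => ω ∈ openConn c a).card}) =
      ∑ B ∈ T.powerset.filter (fun B => B.Nonempty),
        (prodBernoulli w).real ({ω : BondConfig (Fin n) | ∀ s ∈ S, (j + 1 ≤ (A.filter fun a => ω ∈ openConn s a).card ↔ s ∈ S \ B)} ∩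
          ⋃ s ∈ B, (openConn s o : Set (BondConfig (Fin n)))) := by
  have hTS : T ⊆ S := by rw [hS]; exact Finset.subset_insert c T
  have hcS : c ∈ S := by rw [hS]; exact Finset.mem_insert_self c T
  have card_eq : ∀ {u v : Fin n} {ω : BondConfig (Fin n)}, (openGraph ω).Reachable u v →
      (A.filter fun a => ω ∈ openConn u a).card = (A.filter fun a => ω ∈ openConn v a).card := by
    intro u v ω h; congr 1; ext b
    simp only [Finset.mem_filter, openConn, mem_setOf_eq]
    exact and_congr_right fun _ => ⟨fun hub => h.symm.trans hub, fun hvb => h.trans hvb⟩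
  rw [← measureReal_biUnion_finset]
  · congr 1
    ext ω
    simp only [mem_iUnion, exists_prop, Finset.mem_filter, Finset.mem_powerset, mem_setOf_eq, mem_inter_iff, Finset.mem_sdiff]
    constructor
    · rintro ⟨⟨⟨t, htT, hot'⟩, hol⟩, hch⟩
      have hot : (openGraph ω).Reachable o t := hot'
      refine ⟨T.filter (fun s => ¬ j + 1 ≤ (A.filter fun a => ω ∈ openConn s a).card), ⟨Finset.filter_subset _ _, ⟨t, ?_⟩⟩, ?_, ⟨t, ?_, show (openGraph ω).Reachable t o from hot.symm⟩⟩
      · rw [Finset.mem_filter]; refine ⟨htT, ?_⟩; rw [← card_eq hot]; omega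
      · intro s hs
        rw [Finset.mem_filter]
        constructor
        · intro h; exact ⟨hs, fun h' => h'.2 h⟩
        · rintro ⟨_, hnot⟩
          by_contra hlt
          have hsT : s ∈ T := by
            rw [hS, Finset.mem_insert] at hs
            rcases hs with rfl | hsT
            · exact absurd hch hlt
            · exact hsT
          exact hnot ⟨hsT, hlt⟩
      · rw [Finset.mem_filter]; refine ⟨htT, ?_⟩; rw [← card_eq hot]; omega
    · rintro ⟨B, ⟨hBT, _⟩, hpat, ⟨s, hsB, hso'⟩⟩
      have hso : (openGraph ω).Reachable s o := hso'
      have hsl : ¬ (j + 1 ≤ (A.filter fun a => ω ∈ openConn s a).card) := fun h => ((hpat s (hTS (hBT hsB))).1 h).2 hsB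
      refine ⟨⟨⟨s, hBT hsB, show (openGraph ω).Reachable o s from hso.symm⟩, by rw [card_eq hso.symm]; omega⟩, ?_⟩
      exact (hpat c hcS).2 ⟨hcS, fun h => hc (hBT h)⟩
  · intro B hB B' hB' hne
    simp only [Finset.coe_filter, Finset.mem_powerset, mem_setOf_eq] at hB hB'
    have hne' : S \ B ≠ S \ B' := by
      intro h; apply hne
      have e1 : S \ (S \ B) = B := Finset.sdiff_sdiff_eq_self (hB.1.trans hTS)
      have e2 : S \ (S \ B') = B' := Finset.sdiff_sdiff_eq_self (hB'.1.trans hTS)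
      rw [← e1, ← e2, h]
    exact Disjoint.mono inter_subset_left inter_subset_left (pattern_disjoint A S j Finset.sdiff_subset Finset.sdiff_subset hne')
  · intro B _; exact MeasurableSet.of_discrete

end GiantKn

end Summit.CriticalPhenomena.PercolationContinuityZ3.Theorems

end
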